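import Summits.BirchSwinnertonDyer.Rank1Residual.AdditivePotMult.HeegnerIndexRecordsThree
import HarnessLib

/-!
# Heegner-index certificate rows at an ADDITIVE odd prime with IRREDUCIBLE, NON-SURJECTIVE mod-`p` image (both analytic ranks): the schema, an in-kernel Frobenius irreducibility witness, and the two rank-ONE rows (cell `b2b-bsdres`, sub-cell additive-p1, gen 13)

HONEST FRAMING (run/shared/lean/b2b/bsd-rank1-residual/, verbatim): the goal of the cell is to
DELETE the COMBINATION-SHAPED residual classes for ALL analytic-rank `≤ 1` elliptic curves over `ℚ`
— "full BSD formula for every rank `≤ 1` curve in class C" assembled STRICTLY from published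
theorems — so that the rank-`≤ 1` remainder becomes exactly the CONSTRUCTION-SHAPED classes, which
are TYPED (missing-input `Prop`s), NOT attempted. This is not "finishing BSD". X3/X4 stay
CONSTRUCTION-SHAPED; nothing about elliptic curves is asserted here and NOTHING is booked by this
file (a per-pair closure is the referee's / the lane's ruling on the certificates).

Computable DATA records and a decidable recheck, in the pattern and with the helper functions of
x10b's `Rank1ResidualX10bHeegnerIndexRecords` (`vp`, `bInv`, `discr`, `c4`, `isPrimeTD`, `factorsOK`,
`weierstrassEvalZ`) and of this sub-cell's `HeegnerIndexRecordsThree` (`c6`, `isFundDiscNeg`) /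
`HeegnerIndexRecordsThreeRankOne` (p239723). What is NEW relative to those schemas: (i) the prime
`p` is a field (any odd `p`); (ii) NO image clause — instead an in-kernel FROBENIUS IRREDUCIBILITY
WITNESS `frobIrrWitness`: a prime `ℓ ≠ p` of good reduction of the stored model (`ℓ ∤ Δ`) at which
`t² − 4ℓ`, `t = a_ℓ = ℓ + 1 − #E(𝔽_ℓ)` (affine point count of the reduction), is a NON-square mod
`p`; then `x² − t x + ℓ`, the characteristic polynomial of `ρ̄_{E,p}(Frob_ℓ)`, is irreducible over
`𝔽_p`, so `ρ̄_{E,p}` has no `G_ℚ`-stable line (a stable line makes every unramified Frobenius have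
an eigenvalue in `𝔽_p`), i.e. `E[p]` is an IRREDUCIBLE `𝔽_p[G_ℚ]`-module — the only image
hypothesis of the reading theorems (Matar–Nekovář 2019 Thm. 6.7 (1), tree fact A58, through
`RankOneIrreducibleIndexCertificate.lean` p246750 / `RankZeroIrreducibleIndexCertificate.lean`
p247133); the galrep image code at `p` (Cremona/Sutherland: `3Ns`, `3Nn`, `5Ns`, `5Nn`, `5S4`, …) is
carried as DATA; (iii) no potential-type clause (`ord_p j` of either sign: (M) and (G) rows alike;
the additive bit is `p² ∣ N`); (iv) a rank-ZERO row type whose rational point lives on the minimal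
model `F` of the rank-one Heegner twist `E^{(D)}` found by engine 1, with an in-kernel NON-TORSION
witness (generalised Nagell–Lutz, Silverman AEC VII.3.4 over `ℤ`: a torsion point of a Weierstrass
model with integral coefficients has `4x, 8y ∈ ℤ`; so a point `(X/d², Y/d³)` in lowest terms with
`d ≥ 3`, or with `d = 2` and not of order `2`, has infinite order).

ENGINES (VERBATIM copies of the cell's engines, no private engine): engine 1 = x9-g7 / x11c-g3
`main.py` (cypari2; sha256 69e29ec76d23c2dd…), engine 2 = x11c-g3 `run_cert.py` 1b54bb20… /
`e2lib.py` 6701e05d… / `tate_stdlib.py` ed9e5fd9… (python standard library only), twist values =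
this sub-cell's gen-10 PARI script (e501b988…); jobs and outputs: HOME/b2b-bsdres-additive-p1/census-g13/.

READINGS (per pair, nothing booked; the theorems' other binders are PUBLISHED named facts —
Gross–Zagier, Kolyvagin, Matar–Nekovář, GZK, modularity): a consistent `RowOne` with `r_an(E) = 1`
(Cremona) is the certificate of `ClassX4M.bsdp_rankOne_of_indexCertificate` ((M) rows) /
`ClassX4.bsdp_rankOne_of_indexCertificate_of_odd` (any additive type) — `BSD(E,p)`, and `BSD(E^{(D)},p)`
for the rank-zero twist when `D` is odd; a consistent `RowZero` with `r_an(E) = 0` (Cremona) is the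
certificate of `ClassX4M.bsdp_rankZero_of_indexCertificate` / `ClassX4.bsdp_rankZero_of_indexCertificate_of_odd`
— `BSD(E,p)` (the unit `L(E,1)/Ω_E` being read off Cremona's `#Ш_an`, `∏c_ℓ`, `#E(ℚ)_tors`, all
three prime to `p` in a consistent row). NOT rechecked in the kernel (engine work, two engines):
`L(E,1)`, `L'`-values, periods, canonical heights, the `p`-saturation and `E(K)[p] = 0` witnesses, the
non-vanishing `L'(F,1) ≠ 0` that makes `y_K` non-torsion in rank `0`, Cremona's `#Ш_an`, `N = N_E`.

This file: the schema, and the TWO rank-ONE rows of gen 13 — the only Tamagawa-free, optimal,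
`#Ш_an = 1` rank-one pairs with irreducible NON-surjective image in the lane's current residue
(census-g13: 677 such pairs, 675 of them Tamagawa-obstructed): 352800bj1 @3 ((M), `3Nn`, `D = −719`)
and 359856dk1 @3 ((G), `3Nn`, `D = −815`); engine 1 j117556, engine 2 j117642 (m, ord₃ m EQUAL; all
discrete checks true but Cha's `p² ∤ N`), twist values j117643. Rank-ZERO rows: the parts files
`HeegnerIndexRecordsIrreducibleRankZero*.lean`.

References: Matar–Nekovář 2019 Thm. 6.7 (1) [MatarNekovar2019]; Serre 1972 §2 (Frobenius
characteristic polynomials) [Serre1972]; Silverman AEC VII.3.4 [SilvermanAEC2009]; Miller 2011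
Thm. 4.1 [Miller2011LMS]; Cremona's tables [Cremona2006].
-/

set_option autoImplicit false

namespace Summit.BirchSwinnertonDyer.Rank1Residual.AdditivePotMult.HeegnerIndexRecordsIrr

open Summit.BirchSwinnertonDyer.BirchSwinnertonDyer.Rank1Residual.HeegnerIndexRecords
  (vp bInv discr c4 isPrimeTD factorsOK weierstrassEvalZ)
open Summit.BirchSwinnertonDyer.Rank1Residual.AdditivePotMult.HeegnerIndexRecords (c6 isFundDiscNeg)

/-! ### Helpers -/

/-- The number of AFFINE points of the reduction mod `ℓ` of the model with the five given
a-invariants (brute force over `𝔽_ℓ²`; junk `0` otherwise). [folklore] -/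
def affineCountMod (a : List ℤ) (ℓ : ℕ) : ℕ :=
  match a with
  | [a1, a2, a3, a4, a6] =>
      let onCurve : ℕ → ℕ → Bool := fun x y =>
        (((y : ℤ) * (y : ℤ) + a1 * (x : ℤ) * (y : ℤ) + a3 * (y : ℤ) -
          ((x : ℤ) ^ 3 + a2 * (x : ℤ) ^ 2 + a4 * (x : ℤ) + a6)) % (ℓ : ℤ)) == 0
      ((List.range ℓ).flatMap fun x => (List.range ℓ).filter fun y => onCurve x y).length
  | _ => 0

/-- `a_ℓ = ℓ + 1 − #E(𝔽_ℓ) = ℓ − #(affine points)` at a prime `ℓ` of good reduction of the model. [folklore] -/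
def apMod (a : List ℤ) (ℓ : ℕ) : ℤ := (ℓ : ℤ) - (affineCountMod a ℓ : ℤ)

/-- **Frobenius irreducibility witness.** `ℓ` and `p` prime, `p` odd, `ℓ ≠ p`, the model has good
reduction at `ℓ` (`ℓ ∤ Δ`), and `t² − 4ℓ` with `t = a_ℓ` is a NON-square modulo `p`. Then the
characteristic polynomial `x² − t x + ℓ` of `ρ̄_{E,p}(Frob_ℓ)` is irreducible over `𝔽_p`, so `E[p]`
has no `G_ℚ`-stable line: `E[p]` is an irreducible `𝔽_p[G_ℚ]`-module (Serre 1972, §2).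
[cite: Serre1972, §2] -/
def frobIrrWitness (a : List ℤ) (p ℓ : ℕ) : Bool :=
  isPrimeTD ℓ && isPrimeTD p && (p % 2 == 1) && (ℓ != p) && (discr a % (ℓ : ℤ) != 0) &&
    (List.range p).all fun y => (((y : ℤ) * (y : ℤ) - (apMod a ℓ ^ 2 - 4 * (ℓ : ℤ))) % (p : ℤ)) != 0

/-- **Non-torsion witness** for a point `(X/d², Y/d³)` of a Weierstrass model with integral
coefficients `[a₁,…,a₆]` (generalised Nagell–Lutz, Silverman AEC VII.3.4: a torsion point has
`4x, 8y ∈ ℤ`, and `x, y ∈ ℤ` unless it has order `2`): either `d ≥ 3` with `gcd(X, d) = 1` (so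
`4x ∉ ℤ`), or `d = 2` with `X` odd and `2y + a₁x + a₃ ≠ 0` (not of order `2`). [cite: SilvermanAEC2009, Thm. VII.3.4] -/
def nonTorsionWitness (a : List ℤ) (X Y : ℤ) (d : ℕ) : Bool :=
  match a with
  | [a1, _, a3, _, _] =>
      (decide (3 ≤ d) && (Int.gcd X d == 1)) ||
        ((d == 2) && (X % 2 != 0) && (2 * Y + a1 * X * (d : ℤ) + a3 * (d : ℤ) ^ 3 != 0))
  | _ => false

/-! ### Rank ONE rows -/

/-- One rank-ONE exact Heegner-index certificate row at an additive odd prime `p` with irreducible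
(possibly non-surjective) mod-`p` image (module docstring): curve data (Cremona), the Frobenius
witness prime, the Mordell–Weil generator `(GX/Gd², GY/Gd³)` used by the engines, the Heegner field
`D` with factorisation and witness `hw` (`hw² ≡ D mod 4N`), the twist-side values `N_F`,
`#F(ℚ)_tors`, `∏c_ℓ(F)`, `#Ш_an(F)`, and the two engines' `(m, ord_p m)`. [folklore] -/
structure RowOne where
  label : String
  p : ℕ
  pot : String
  ainvs : List ℤ
  N : ℕ
  Nfactors : List (ℕ × ℕ)
  irrWitness : ℕ
  image : String
  optcode : ℕ
  manin : ℕ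
  tors : ℕ
  tam : ℕ
  GX : ℤ
  GY : ℤ
  Gd : ℕ
  D : ℤ
  Dfactors : List (ℕ × ℕ)
  hw : ℕ
  NF : ℕ
  Ftors : ℕ
  Ftam : ℕ
  FshaAn : ℕ
  m1 : ℕ
  v1 : ℕ
  m2 : ℕ
  v2 : ℕ
  deriving DecidableEq, Repr

/-- The in-kernel recheck of a rank-one row: `p` odd prime, `p² ∣ N` (additive), `Δ ≠ 0`, Frobenius
irreducibility witness at `p`, `D < −4` fundamental with `p ∤ D`, `(D, N) = 1` and the Heegner
witness, the generator ON the curve, `p ∤ #E(ℚ)_tors·∏c_ℓ(E)`, Manin `1` with optimality code `≥ 1`,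
`N_F = N·D²`, `p ∤ #F(ℚ)_tors·#Ш_an(F)·∏c_ℓ(F)` (unit twist value), and the engines' agreement
`m₁ = m₂`, `ord_p m₁ = ord_p m₂ = 0`. [folklore] -/
def RowOne.consistent (r : RowOne) : Bool :=
  isPrimeTD r.p && (r.p % 2 == 1) && (r.ainvs.length == 5) && factorsOK r.N r.Nfactors &&
  (r.N % (r.p * r.p) == 0) && (discr r.ainvs != 0) && frobIrrWitness r.ainvs r.p r.irrWitness &&
  decide (r.D < -4) && (r.D % (r.p : ℤ) != 0) && (Int.gcd r.D r.N == 1) && isFundDiscNeg r.D r.Dfactors &&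
  ((((r.hw : ℤ) ^ 2 - r.D) % (4 * (r.N : ℤ))) == 0) &&
  decide (1 ≤ r.Gd) && (weierstrassEvalZ r.ainvs r.GX r.GY r.Gd == 0) &&
  (r.tors % r.p != 0) && (r.tam % r.p != 0) && decide (1 ≤ r.optcode) && (r.manin == 1) &&
  (r.NF == r.N * r.D.natAbs * r.D.natAbs) && (r.Ftors % r.p != 0) && decide (1 ≤ r.FshaAn) &&
  ((r.FshaAn * r.Ftam) % r.p != 0) &&
  (r.m1 == r.m2) && (r.v1 == 0) && (r.v2 == 0) && (r.m1 % r.p != 0)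

/-- A list of rank-one rows is `CheckedOne` when every row is consistent. [folklore] -/
def CheckedOne (rs : List RowOne) : Prop := rs.all RowOne.consistent = true

/-- `CheckedOne rs` is decidable. [folklore] -/
instance CheckedOne.instDecidable (rs : List RowOne) : Decidable (CheckedOne rs) :=
  inferInstanceAs (Decidable (rs.all RowOne.consistent = true))

/-- Unpacking `CheckedOne`. [folklore] -/
theorem CheckedOne.consistent_of_mem {rs : List RowOne} (h : CheckedOne rs) {r : RowOne}
    (hr : r ∈ rs) : r.consistent = true :=
  List.all_eq_true.1 h r hr

/-! ### Rank ZERO rows -/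

/-- One rank-ZERO exact Heegner-index certificate row at an additive odd prime `p` with irreducible
(possibly non-surjective) mod-`p` image (module docstring): curve data (Cremona, including `#Ш_an(E)`),
the Frobenius witness prime, the Heegner field `D` (factorisation, witness `hw`), the minimal model
`F` of the rank-one twist `E^{(D)}` with a twist witness `tw` and the rational point `(PX/Pd², PY/Pd³)`
found by engine 1, `N_F`, and the two engines' `(m, ord_p m)`. [folklore] -/
structure RowZero where
  label : String
  p : ℕ
  pot : String
  ainvs : List ℤ
  N : ℕ
  Nfactors : List (ℕ × ℕ)
  irrWitness : ℕ
  image : String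
  optcode : ℕ
  manin : ℕ
  tors : ℕ
  tam : ℕ
  shaAn : ℕ
  D : ℤ
  Dfactors : List (ℕ × ℕ)
  hw : ℕ
  Fainvs : List ℤ
  tw : ℕ
  NF : ℕ
  PX : ℤ
  PY : ℤ
  Pd : ℕ
  m1 : ℕ
  v1 : ℕ
  m2 : ℕ
  v2 : ℕ
  deriving DecidableEq, Repr

/-- `F` is the `D`-twist of `E` over `ℚ`: `j(F) = j(E)` (`c₄(F)³Δ(E) = c₄(E)³Δ(F)`) and
`c₆(F)c₄(E)c₄(F)c₆(E)·D = tw²` is a non-zero square (so the twisting parameter is `D` up to squares;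
`c₄c₆ ≠ 0`). As in `HeegnerIndexRecordsThree`. [folklore] -/
def RowZero.twistOK (r : RowZero) : Bool :=
  (c4 r.Fainvs ^ 3 * discr r.ainvs == c4 r.ainvs ^ 3 * discr r.Fainvs) &&
  decide (0 < r.tw) && ((c6 r.Fainvs * c4 r.ainvs * c4 r.Fainvs * c6 r.ainvs * r.D) == (r.tw : ℤ) ^ 2)

/-- The in-kernel recheck of a rank-zero row: `p` odd prime, `p² ∣ N`, `Δ ≠ 0`, Frobenius
irreducibility witness at `p`, `D < −4` fundamental with `p ∤ D`, `(D, N) = 1` and the Heegner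
witness, `F` a twist of `E` by `D` (`twistOK`), `N_F = N·D²`, the point ON `F` with a non-torsion
witness, `p ∤ #E(ℚ)_tors·∏c_ℓ(E)·#Ш_an(E)` (so `ord_p (L(E,1)/Ω_E) = 0`), Manin `1` with optimality
code `≥ 1`, and the engines' agreement `m₁ = m₂`, `ord_p m₁ = ord_p m₂ = 0`. [folklore] -/
def RowZero.consistent (r : RowZero) : Bool :=
  isPrimeTD r.p && (r.p % 2 == 1) && (r.ainvs.length == 5) && (r.Fainvs.length == 5) &&
  factorsOK r.N r.Nfactors && (r.N % (r.p * r.p) == 0) && (discr r.ainvs != 0) &&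
  frobIrrWitness r.ainvs r.p r.irrWitness &&
  decide (r.D < -4) && (r.D % (r.p : ℤ) != 0) && (Int.gcd r.D r.N == 1) && isFundDiscNeg r.D r.Dfactors &&
  ((((r.hw : ℤ) ^ 2 - r.D) % (4 * (r.N : ℤ))) == 0) &&
  r.twistOK && (r.NF == r.N * r.D.natAbs * r.D.natAbs) &&
  decide (1 ≤ r.Pd) && (weierstrassEvalZ r.Fainvs r.PX r.PY r.Pd == 0) &&
  nonTorsionWitness r.Fainvs r.PX r.PY r.Pd &&
  (r.tors % r.p != 0) && (r.tam % r.p != 0) && decide (1 ≤ r.shaAn) && (r.shaAn % r.p != 0) &&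
  decide (1 ≤ r.optcode) && (r.manin == 1) &&
  (r.m1 == r.m2) && (r.v1 == 0) && (r.v2 == 0) && (r.m1 % r.p != 0)

/-- A list of rank-zero rows is `CheckedZero` when every row is consistent. [folklore] -/
def CheckedZero (rs : List RowZero) : Prop := rs.all RowZero.consistent = true

/-- `CheckedZero rs` is decidable. [folklore] -/
instance CheckedZero.instDecidable (rs : List RowZero) : Decidable (CheckedZero rs) :=
  inferInstanceAs (Decidable (rs.all RowZero.consistent = true))

/-- Unpacking `CheckedZero`. [folklore] -/
theorem CheckedZero.consistent_of_mem {rs : List RowZero} (h : CheckedZero rs) {r : RowZero}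
    (hr : r ∈ rs) : r.consistent = true :=
  List.all_eq_true.1 h r hr

/-! ### The two rank-ONE rows of gen 13 -/

/-- **The rank-ONE exact Heegner-index certificate rows at `p = 3` with NON-surjective irreducible
image (`3Nn`), sub-cell additive-p1 gen 13 (census-g13; engine 1 j117556, engine 2 j117642, twist
values j117643): 2 rows, both CONSISTENT** — 352800bj1 (potentially multiplicative, cell E-iii ∧ ¬Surj;
`D = −719`, `m = 80`) and 359856dk1 (potentially good; `D = −815`, `m = 56`); the twist-side values are
`3`-units (`#Ш_an(F) = 25`, `∏c(F) = 64`, `#F(ℚ)_tors = 2`, resp. `49`, `8`, `1`); both `D` odd. With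
`r_an(E) = 1` (Cremona) these are the certificates of `ClassX4M.bsdp_rankOne_of_indexCertificate`
(p246750; resp. `ClassX4.bsdp_rankOne_of_indexCertificate_of_odd`): `BSD(E,3)` and `BSD(E^{(D)},3)`
per pair, modulo the referee's ruling. `decide` evaluates the checks of `RowOne.consistent`.
Nothing about elliptic curves is asserted; nothing booked. -/
theorem checkedOne_nonsurj_three_rankOne : CheckedOne [
  { label := "352800bj1", p := 3, pot := "M", ainvs := [0, 0, 0, (-149205), 21849100], N := 352800, Nfactors := [(2, 5), (3, 2), (5, 2), (7, 2)],
    irrWitness := 11, image := "3Nn", optcode := 1, manin := 1, tors := 2, tam := 16,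
    GX := 200, GY := 90, Gd := 1,
    D := (-719), Dfactors := [(719, 1)], hw := 31609, NF := 182383840800, Ftors := 2, Ftam := 64, FshaAn := 25,
    m1 := 80, v1 := 0, m2 := 80, v2 := 0 },
  { label := "359856dk1", p := 3, pot := "G", ainvs := [0, 0, 0, (-740880), (-152473104)], N := 359856, Nfactors := [(2, 4), (3, 3), (7, 2), (17, 1)],
    irrWitness := 11, image := "3Nn", optcode := 1, manin := 1, tors := 1, tam := 2,
    GX := (-18213025943), GY := 3100818652171723, Gd := 7676,
    D := (-815), Dfactors := [(5, 1), (163, 1)], hw := 4489, NF := 239025351600, Ftors := 1, Ftam := 8, FshaAn := 49,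
    m1 := 56, v1 := 0, m2 := 56, v2 := 0 }
  ] := by
  decide +kernel

end Summit.BirchSwinnertonDyer.Rank1Residual.AdditivePotMult.HeegnerIndexRecordsIrr
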